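import Literature.Probability.LatticeModels.UrsellMonotonicityTwo
import Literature.Probability.LatticeModels.UrsellFirstZeroPinned
import HarnessLib

/-!
# The truncated correlation `⟨σ_uσ_v ; σ_w⟩` by random currents with a ghost spin, at real and imaginary fields

Topic `Literature/Probability/LatticeModels`.  For the pair-interaction Ising model on a finite set `ι`
(`PairIsing.weight c σ = exp(Σ_{a,b} c_{ab} σ_aσ_b)`, `c ≥ 0`) with site-dependent magnetic fields `h`,
write `Sh_c[F](h) = Σ_σ F(σ) sinh(Σ_x h_xσ_x) w_c(σ)` and `Ch_c[F](h)` (cosh) for the odd and even parts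
of the field sums (`PairIsing.sinhSum`, `PairIsing.coshSum`).  The main results:

* `PairIsing.exists_kappa_truncated_pair_field` — **the random-current representation of the truncated
  correlation `⟨σ_uσ_v ; σ_w⟩` with conditioning on the cluster of `w`**, in unnormalised form: there are
  coefficients `κ_{K,a} ≥ 0` (`K ⊆ ι`, `a ∈ ι`) NOT DEPENDING ON THE FIELDS such that for all `h ≥ 0`
  `Sh_c[σ_uσ_vσ_w] Ch_c[1] − Ch_c[σ_uσ_v] Sh_c[σ_w] = Σ_{K,a} κ_{K,a} · Sh_{c|K}[σ_a](h|K) · Ch_{c|K}[1](h|K)`,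
  where `c|K = cSub K c`, `h|K = lamSub K h` is the induced sub-model on `K` (same index type, the sites
  off `K` isolated and field-free).  Mechanism: Griffiths' ghost vertex `g` (the field as couplings `h_x/2`
  to an extra site, `PairIsing.ghostCouplings`, index type `Option ι`), the Ising dictionary
  `Σ_σ σ_A w = e^{tr c} 2^{|V|} Z_K[A]` (`PairIsing.sum_spinProduct_weight_eq`), the switching lemma in the
  form `Z[T]Z[∅] − Z[TΔ{w,g}]Z[{w,g}] = D_{w,g}(T)` (`Current.toReal_dmass` of `UrsellMonotonicityTwo`),
  and the decomposition of the switched mass `D` according to the cluster `B` of `w`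
  (`Current.dmass_eq_sum_innerMass`: inner mass `Current.innerMass` × current sums of the couplings cut off
  at `B`); the inner masses do not see the ghost edges (`innerMass_ghost_eq`), the cut-off model is the ghost
  model of the sub-model (`cutCoupling_edgeK`, `cSub_compl_ghostCouplings`), and odd source sets contribute
  nothing (`wcurrentSum_edgeK_eq_zero_of_odd`, `odd_card_sdiff_of_not_exists`).
* `PairIsing.rc_imaginary_field` — **the same identity at the imaginary fields `h = iθλ`** (both sides are
  entire in each `h_x`; identity theorem coordinate by coordinate, `eq_of_eqOn_nonneg_orthant`):
  `S_{uvw}(θ) Z(θ) − N_{uv}(θ) S_w(θ) = Σ_{K,a} κ_{K,a} S^K_a(θ) Z_K(θ)` with `S_A = Σ σ_A sin(θX) w`,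
  `Z = Σ cos(θX) w`, `N_{uv} = Σ σ_uσ_v cos(θX) w`, `X = Σ λ_xσ_x` — exactly the hypothesis `hRC` of
  `CamiaJiangNewman2023_thm2_of_rc` (`UrsellFirstZeroFromCurrents.lean`), which turns it into
  Camia–Jiang–Newman 2023, Theorem 2.

Also here: `Current.wweight_congr` (weights only see the couplings on the support), the sub-model
vocabulary `PairIsing.cSub`, `PairIsing.lamSub`, the ghost dictionary `sum_mul_spinAt_none_mul_weight_ghost` /
`sum_mul_weight_ghost`, and the complex field sums `sinhSumC`, `coshSumC`, `maskC`.  No named facts.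

## References

* [DuminilCopin2016] H. Duminil-Copin, *Random currents expansion of the Ising model*, arXiv:1607.06933,
  §2 (Griffiths' ghost vertex, eq. (2.2)), Lemma 3.1 (switching lemma) and the display after Prop. 3.3
  (Griffiths' second inequality by switching) — held, read pp. 5, 8.
* [AizenmanCMP1982] M. Aizenman, Comm. Math. Phys. 86 (1982) 1–48, §5 (conditioning on clusters).
* R. B. Griffiths, C. A. Hurst, S. Sherman, J. Math. Phys. 11 (1970) 790 (GHS; switching).
* [Panis2023Triviality] R. Panis, arXiv:2309.05797, §4.1 (the dictionary for pair interactions).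
* [CamiaJiangNewman2023] F. Camia, J. Jiang, C. M. Newman, CMP 401 (2023), Thm 2 (the consumer).
-/

noncomputable section

open Finset
open scoped symmDiff ENNReal

namespace Literature.Probability.LatticeModels

variable {V : Type*} [Fintype V] [DecidableEq V] {G : SimpleGraph V} [DecidableRel G.Adj]

namespace Current

variable {K : G.edgeFinset → ℝ}


/-! ### Weights only see the couplings on the support -/

omit [DecidableEq V] in
/-- `w_K(n) = w_{K'}(n)` when `K` and `K'` agree on the edges carrying current. [folklore] -/
theorem wweight_congr {K K' : G.edgeFinset → ℝ} {n : Current G} (h : ∀ e, n e ≠ 0 → K e = K' e) :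
    n.wweight K = n.wweight K' := by
  unfold wweight
  refine Finset.prod_congr rfl fun e _ => ?_
  by_cases hn : n e = 0
  · rw [hn, pow_zero, pow_zero]
  · rw [h e hn]

omit [DecidableEq V] in
/-- The same for the `ℝ≥0∞` weights. [folklore] -/
theorem eweight_congr {K K' : G.edgeFinset → ℝ} {n : Current G} (h : ∀ e, n e ≠ 0 → K e = K' e) :
    n.eweight K = n.eweight K' := by
  unfold eweight; rw [wweight_congr h]

/-! ### The inner (frozen-cluster) mass and the cluster decomposition of the switched mass -/

/-- **The inner mass of a frozen cluster**: the weight of the pairs of currents `(m₁, m₂)` living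
inside `B`, with `C_{m₁+m₂}(s) = B`, `∂m₁ = S`, `∂m₂ = ∅`:
`I_B(S) = Σ 1{m ⊑ B} 1{C_{m₁+m₂}(s) = B} 1{∂m₁ = S} 1{∂m₂ = ∅} w(m₁) w(m₂)`.
[cite: AizenmanCMP1982, §5 (conditioning on clusters)] -/
def innerMass (K : G.edgeFinset → ℝ) (s : V) (B S : Finset V) : ℝ≥0∞ :=
  ∑' m : Current G × Current G,
    if IsSupp (offGraph G Bᶜ) m.1 ∧ IsSupp (offGraph G Bᶜ) m.2 ∧ (m.1 + m.2).cluster s = B ∧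
        m.1.sources = S ∧ m.2.sources = ∅ then m.1.eweight K * m.2.eweight K else 0

/-- **The inner mass only sees the couplings inside `B`.** [folklore] -/
theorem innerMass_congr {K K' : G.edgeFinset → ℝ} {B : Finset V}
    (h : ∀ e : G.edgeFinset, (∀ v ∈ (e : Sym2 V), v ∈ B) → K e = K' e) (s : V) (S : Finset V) :
    innerMass K s B S = innerMass K' s B S := by
  unfold innerMass
  refine tsum_congr fun m => ?_
  split_ifs with hm
  · rw [eweight_congr fun e he => h e ((isSupp_offGraph_compl_iff B m.1).1 hm.1 e he),
      eweight_congr fun e he => h e ((isSupp_offGraph_compl_iff B m.2).1 hm.2.1 e he)]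
  · rfl

/-- The inner mass vanishes unless `s ∈ B`. [folklore] -/
theorem innerMass_eq_zero_of_not_mem (K : G.edgeFinset → ℝ) {s : V} {B : Finset V} (hs : s ∉ B)
    (S : Finset V) : innerMass K s B S = 0 := by
  unfold innerMass
  refine ENNReal.tsum_eq_zero.2 fun m => ?_
  rw [if_neg]
  rintro ⟨-, -, hcl, -⟩
  exact hs (hcl ▸ mem_cluster_self _ s)

/-- **Cluster decomposition of the switched mass** (conditioning on the cluster `B = C_{p₁+p₂}(s)`):
`D_{s,g}(T) = Σ_{B ∌ g} I_B(T ∩ B) · Z_{K_B}[T ∖ B] · Z_{K_B}[∅]`, where `K_B` are the couplings cut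
off at `B` (the sub-model off `B`): inside `B` the pair has sources `T ∩ B, ∅` and spans the cluster,
outside it is a free pair of currents of the sub-model with sources `T ∖ B, ∅`.
[cite: AizenmanCMP1982, §5 (conditioning on clusters)] -/
theorem dmass_eq_sum_innerMass (hK : ∀ e, 0 ≤ K e) (s g : V) (T : Finset V) :
    dmass K s g T = ∑ B : Finset V, (if g ∈ B then 0 else 1) * innerMass K s B (T ∩ B) *
      (ecurrentSum (cutCoupling K B) (T \ B) * ecurrentSum (cutCoupling K B) ∅) := by
  classical
  set Φ : Current G × Current G → ℝ≥0∞ := fun p =>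
    (if p.1.sources = T ∧ p.2.sources = ∅ then 1 else 0) *
      (if g ∈ (p.1 + p.2).cluster s then 0 else 1) with hΦ
  have h1 : dmass K s g T = ∑' p : Current G × Current G, p.1.eweight K * p.2.eweight K * Φ p := by
    unfold dmass epairWeight
    refine tsum_congr fun p => ?_
    by_cases hp : p.1.sources = T ∧ p.2.sources = ∅
    · simp only [hΦ, if_pos hp, one_mul]
    · simp only [hΦ, if_neg hp, zero_mul, mul_zero]
  rw [h1, tsum_pair_eq_sum_cluster hK s Φ]
  refine Finset.sum_congr rfl fun B _ => ?_
  set F : Current G × Current G → ℝ≥0∞ := fun m =>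
    if IsSupp (offGraph G Bᶜ) m.1 ∧ IsSupp (offGraph G Bᶜ) m.2 ∧ (m.1 + m.2).cluster s = B ∧
        m.1.sources = T ∩ B ∧ m.2.sources = ∅ then m.1.eweight K * m.2.eweight K else 0 with hF
  have hI : innerMass K s B (T ∩ B) = ∑' m, F m := rfl
  -- identify the summand
  have h2 : ∀ q : (Current G × Current G) × (Current G × Current G),
      (if IsSupp (offGraph G Bᶜ) q.1.1 ∧ IsSupp (offGraph G Bᶜ) q.1.2 ∧
            (q.1.1 + q.1.2).cluster s = B then eweight K q.1.1 * eweight K q.1.2 else 0) *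
        (if IsSupp (offGraph G B) q.2.1 ∧ IsSupp (offGraph G B) q.2.2
            then eweight K q.2.1 * eweight K q.2.2 else 0) *
        Φ (q.1.1 + q.2.1, q.1.2 + q.2.2) =
      F q.1 * (epairWeight (cutCoupling K B) (T \ B) ∅ q.2 * (if g ∈ B then 0 else 1)) := by
    intro q
    rw [epairWeight_cutCoupling]
    by_cases hin : IsSupp (offGraph G Bᶜ) q.1.1 ∧ IsSupp (offGraph G Bᶜ) q.1.2 ∧
        (q.1.1 + q.1.2).cluster s = B
    swap
    · have hF0 : F q.1 = 0 :=
        if_neg fun h : IsSupp (offGraph G Bᶜ) q.1.1 ∧ IsSupp (offGraph G Bᶜ) q.1.2 ∧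
            (q.1.1 + q.1.2).cluster s = B ∧ q.1.1.sources = T ∩ B ∧ q.1.2.sources = ∅ =>
          hin ⟨h.1, h.2.1, h.2.2.1⟩
      rw [if_neg hin, hF0, zero_mul, zero_mul, zero_mul]
    by_cases hout : IsSupp (offGraph G B) q.2.1 ∧ IsSupp (offGraph G B) q.2.2
    swap
    · have hO : (if (IsSupp (offGraph G B) q.2.1 ∧ q.2.1.sources = T \ B) ∧
          (IsSupp (offGraph G B) q.2.2 ∧ q.2.2.sources = ∅) then q.2.1.eweight K * q.2.2.eweight K
          else (0 : ℝ≥0∞)) = 0 := if_neg fun h => hout ⟨h.1.1, h.2.1⟩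
      rw [if_neg hout, hO, mul_zero, zero_mul, zero_mul, mul_zero]
    obtain ⟨h11, h12, hcl⟩ := hin
    obtain ⟨h21, h22⟩ := hout
    have hs1 := sources_add_eq_iff_of_isSupp h11 h21 T
    have hs2 : (q.1.2 + q.2.2).sources = ∅ ↔ q.1.2.sources = ∅ ∧ q.2.2.sources = ∅ := by
      have := sources_add_eq_iff_of_isSupp h12 h22 (∅ : Finset V)
      rwa [Finset.empty_inter, Finset.empty_sdiff] at this
    have hcl' : (q.1.1 + q.2.1 + (q.1.2 + q.2.2)).cluster s = B := by
      rw [add_add_add_comm]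
      exact cluster_add_eq_of_isSupp (isSupp_add h11 h12) (isSupp_add h21 h22) hcl
    rw [if_pos (And.intro h11 (And.intro h12 hcl)), if_pos (And.intro h21 h22)]
    simp only [hΦ, hcl']
    by_cases hall : q.1.1.sources = T ∩ B ∧ q.2.1.sources = T \ B ∧ q.1.2.sources = ∅ ∧
        q.2.2.sources = ∅
    · obtain ⟨ha, hb, hc, hd⟩ := hall
      have hL : (if (q.1.1 + q.2.1).sources = T ∧ (q.1.2 + q.2.2).sources = ∅ then (1 : ℝ≥0∞) else 0) = 1 :=
        if_pos ⟨hs1.2 ⟨ha, hb⟩, hs2.2 ⟨hc, hd⟩⟩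
      have hFq : F q.1 = q.1.1.eweight K * q.1.2.eweight K := if_pos ⟨h11, h12, hcl, ha, hc⟩
      have hO : (if (IsSupp (offGraph G B) q.2.1 ∧ q.2.1.sources = T \ B) ∧
          (IsSupp (offGraph G B) q.2.2 ∧ q.2.2.sources = ∅) then q.2.1.eweight K * q.2.2.eweight K
          else (0 : ℝ≥0∞)) = q.2.1.eweight K * q.2.2.eweight K := if_pos ⟨⟨h21, hb⟩, ⟨h22, hd⟩⟩
      rw [hL, hFq, hO]
      ring
    · have hL : (if (q.1.1 + q.2.1).sources = T ∧ (q.1.2 + q.2.2).sources = ∅ then (1 : ℝ≥0∞) else 0) = 0 :=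
        if_neg fun h => hall ⟨(hs1.1 h.1).1, (hs1.1 h.1).2, (hs2.1 h.2).1, (hs2.1 h.2).2⟩
      rw [hL, zero_mul, mul_zero]
      symm
      by_cases hac : q.1.1.sources = T ∩ B ∧ q.1.2.sources = ∅
      · have hO : (if (IsSupp (offGraph G B) q.2.1 ∧ q.2.1.sources = T \ B) ∧
            (IsSupp (offGraph G B) q.2.2 ∧ q.2.2.sources = ∅) then q.2.1.eweight K * q.2.2.eweight K
            else (0 : ℝ≥0∞)) = 0 := if_neg fun h => hall ⟨hac.1, h.1.2, hac.2, h.2.2⟩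
        rw [hO, zero_mul, mul_zero]
      · have hF0 : F q.1 = 0 :=
          if_neg fun h : IsSupp (offGraph G Bᶜ) q.1.1 ∧ IsSupp (offGraph G Bᶜ) q.1.2 ∧
              (q.1.1 + q.1.2).cluster s = B ∧ q.1.1.sources = T ∩ B ∧ q.1.2.sources = ∅ =>
            hac ⟨h.2.2.2.1, h.2.2.2.2⟩
        rw [hF0, zero_mul]
  rw [tsum_congr h2, ← tsum_mul_tsum_eq_tsum_prod F
      (fun k => epairWeight (cutCoupling K B) (T \ B) ∅ k * (if g ∈ B then (0 : ℝ≥0∞) else 1)),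
    ENNReal.tsum_mul_right, tsum_epairWeight, hI]
  ring

end Current

/-! ### The pair-interaction model: dictionary, parity, cut-off couplings -/

namespace PairIsing

section General

variable {V : Type*} [Fintype V] [DecidableEq V]



/-- Couplings restricted to `K × K` (the induced sub-model on `K`, same index type). [folklore] -/
def cSub (K : Finset V) (c : V → V → ℝ) : V → V → ℝ :=
  fun a b => if a ∈ K ∧ b ∈ K then c a b else 0

/-- Weights (or fields) restricted to `K`. [folklore] -/
def lamSub (K : Finset V) (lam : V → ℝ) : V → ℝ := fun a => if a ∈ K then lam a else 0

omit [Fintype V] in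
/-- `cSub K c ≥ 0` for `c ≥ 0`. [folklore] -/
theorem cSub_nonneg (K : Finset V) {c : V → V → ℝ} (hc : ∀ a b, 0 ≤ c a b) (a b : V) :
    0 ≤ cSub K c a b := by
  unfold cSub; split_ifs; exacts [hc a b, le_rfl]

omit [Fintype V] in
/-- `lamSub K λ ≥ 0` for `λ ≥ 0`. [folklore] -/
theorem lamSub_nonneg (K : Finset V) {lam : V → ℝ} (hlam : ∀ a, 0 ≤ lam a) (a : V) :
    0 ≤ lamSub K lam a := by
  unfold lamSub; split_ifs; exacts [hlam a, le_rfl]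

omit [Fintype V] in
/-- `cSub K c a b = c a b` on `K × K`. [folklore] -/
theorem cSub_apply_of_mem {K : Finset V} (c : V → V → ℝ) {a b : V} (ha : a ∈ K) (hb : b ∈ K) :
    cSub K c a b = c a b := by
  unfold cSub; rw [if_pos ⟨ha, hb⟩]

omit [Fintype V] in
/-- `cSub K c a b = 0` off `K × K`. [folklore] -/
theorem cSub_apply_of_not {K : Finset V} (c : V → V → ℝ) {a b : V} (h : ¬(a ∈ K ∧ b ∈ K)) :
    cSub K c a b = 0 := by
  unfold cSub; rw [if_neg h]

/-- **The unnormalised dictionary**: `Σ_σ σ_A w_c(σ) = e^{Σ_a c_{aa}} 2^{|V|} Z_K[A]` with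
`K = edgeK c` on the complete graph. [cite: Panis2023Triviality, §4.1] -/
theorem sum_spinProduct_weight_eq {c : V → V → ℝ} (hc : ∀ a b, 0 ≤ c a b) (A : Finset V) :
    (∑ σ : SpinConfig V, spinProduct A σ * weight c σ) =
      Real.exp (∑ a, c a a) * 2 ^ Fintype.card V * wcurrentSum (edgeK c) A := by
  have hw : ∀ σ : SpinConfig V, weight c σ = Real.exp (∑ a, c a a) *
      ∏ e : (⊤ : SimpleGraph V).edgeFinset, Real.exp (edgeK c e * bondSpin σ (e : Sym2 V)) := by
    intro σ
    have h := exp_pair_sum_eq_mul_prod c 2 σ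
    rw [show (2 : ℝ) / 2 = 1 by norm_num, one_mul, one_mul] at h
    rw [← h, weight]
    simp only [mul_assoc]
  calc (∑ σ : SpinConfig V, spinProduct A σ * weight c σ)
      = Real.exp (∑ a, c a a) * ∑ σ : SpinConfig V, spinProduct A σ *
          ∏ e : (⊤ : SimpleGraph V).edgeFinset, Real.exp (edgeK c e * bondSpin σ (e : Sym2 V)) := by
        rw [Finset.mul_sum]
        exact Finset.sum_congr rfl fun σ _ => by rw [hw σ]; ring
    _ = Real.exp (∑ a, c a a) * 2 ^ Fintype.card V * wcurrentSum (edgeK c) A := by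
        rw [sum_spinProduct_mul_prod_exp_eq (edgeK_nonneg hc) A]; ring

/-- **Spin flip**: `Σ_σ σ_A w_c(σ) = 0` for `|A|` odd. [folklore] -/
theorem sum_spinProduct_weight_eq_zero_of_odd (c : V → V → ℝ) {A : Finset V} (hA : Odd #A) :
    (∑ σ : SpinConfig V, spinProduct A σ * weight c σ) = 0 := by
  have h := Fintype.sum_equiv (Equiv.neg (SpinConfig V))
    (fun σ => spinProduct A σ * weight c σ) (fun σ => -(spinProduct A σ * weight c σ))
    (fun σ => by rw [Equiv.neg_apply, spinProduct_neg, weight_neg, hA.neg_one_pow]; ring)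
  rw [Finset.sum_neg_distrib] at h
  linarith

/-- Hence `Z_K[A] = 0` for `|A|` odd. [folklore] -/
theorem wcurrentSum_edgeK_eq_zero_of_odd {c : V → V → ℝ} (hc : ∀ a b, 0 ≤ c a b) {A : Finset V}
    (hA : Odd #A) : wcurrentSum (edgeK c) A = 0 := by
  have h := sum_spinProduct_weight_eq hc A
  rw [sum_spinProduct_weight_eq_zero_of_odd c hA] at h
  have hpos : 0 < Real.exp (∑ a, c a a) * 2 ^ Fintype.card V := by positivity
  rcases mul_eq_zero.1 h.symm with h1 | h1
  · exact absurd h1 hpos.ne'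
  · exact h1

/-- **Cutting off the couplings at `B` = the induced sub-model on `Bᶜ`**:
`cutCoupling (edgeK c) B = edgeK (cSub Bᶜ c)`. [folklore] -/
theorem cutCoupling_edgeK (c : V → V → ℝ) (B : Finset V) :
    cutCoupling (edgeK c) B = edgeK (cSub Bᶜ c) := by
  funext e
  obtain ⟨e, he⟩ := e
  induction e using Sym2.ind with
  | _ a b =>
    rw [cutCoupling]
    change (if Current.EdgeOff B s(a, b) then pairEdgeWeight c 2 ⟨s(a, b), he⟩ else 0) =
      pairEdgeWeight (cSub Bᶜ c) 2 ⟨s(a, b), he⟩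
    rw [pairEdgeWeight_apply_mk, pairEdgeWeight_apply_mk]
    unfold cSub
    simp only [Finset.mem_compl, Current.edgeOff_mk]
    by_cases ha : a ∈ B <;> by_cases hb : b ∈ B <;> simp [ha, hb]

end General

/-! ### The magnetic field as a ghost site -/

section Ghost

variable {ι : Type*} [Fintype ι] [DecidableEq ι]

/-- The couplings on `Option ι` realising the fields `h` as couplings to the ghost site `none`:
`c'(x,y) = c(x,y)`, `c'(g,x) = c'(x,g) = h_x/2`, `c'(g,g) = 0`. [cite: DuminilCopin2016, §2 (Griffiths' ghost vertex)] -/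
def ghostCouplings (c : ι → ι → ℝ) (h : ι → ℝ) : Option ι → Option ι → ℝ
  | some x, some y => c x y
  | none, some x => h x / 2
  | some x, none => h x / 2
  | none, none => 0

omit [Fintype ι] [DecidableEq ι] in
/-- The ghost couplings are non-negative for `c, h ≥ 0`. [folklore] -/
theorem ghostCouplings_nonneg {c : ι → ι → ℝ} (hc : ∀ a b, 0 ≤ c a b) {h : ι → ℝ} (hh : ∀ a, 0 ≤ h a) :
    ∀ a b, 0 ≤ ghostCouplings c h a b := by
  rintro (_ | x) (_ | y) <;> simp [ghostCouplings, hc, hh, div_nonneg]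

omit [DecidableEq ι] in
/-- The trace of the ghost couplings is that of `c`. [folklore] -/
theorem sum_ghostCouplings_diag (c : ι → ι → ℝ) (h : ι → ℝ) :
    (∑ a, ghostCouplings c h a a) = ∑ x, c x x := by
  rw [Fintype.sum_option]
  simp [ghostCouplings]

/-- Restricting a configuration on `Option ι` to `ι`. [folklore] -/
abbrev restrictSome (σ : SpinConfig (Option ι)) : SpinConfig ι := fun x => σ (some x)

omit [Fintype ι] [DecidableEq ι] in
/-- `σ̂|_ι` at `x` is `σ̂` at `some x`. [folklore] -/
@[simp] theorem spinAt_restrictSome (σ : SpinConfig (Option ι)) (x : ι) :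
    spinAt x (restrictSome σ) = spinAt (some x) σ := rfl

omit [DecidableEq ι] in
/-- **The Boltzmann weight with the ghost site**:
`w_{c'}(σ̂) = w_c(σ̂|_ι) · exp(σ̂_g Σ_x h_x σ̂_x)`. [cite: DuminilCopin2016, §2 (Griffiths' ghost vertex)] -/
theorem weight_ghostCouplings (c : ι → ι → ℝ) (h : ι → ℝ) (σ : SpinConfig (Option ι)) :
    weight (ghostCouplings c h) σ =
      weight c (restrictSome σ) * Real.exp (spinAt none σ * ∑ x, h x * spinAt (some x) σ) := by
  unfold weight
  rw [← Real.exp_add]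
  congr 1
  simp only [Fintype.sum_option, ghostCouplings, zero_mul, zero_add, spinAt_restrictSome, sum_add_distrib]
  have hS1 : (∑ y, h y / 2 * (spinAt none σ * spinAt (some y) σ)) =
      (spinAt none σ * ∑ x, h x * spinAt (some x) σ) / 2 := by
    rw [mul_sum, sum_div]; exact sum_congr rfl fun x _ => by ring
  have hS2 : (∑ x, h x / 2 * (spinAt (some x) σ * spinAt none σ)) =
      (spinAt none σ * ∑ x, h x * spinAt (some x) σ) / 2 := by
    rw [mul_sum, sum_div]; exact sum_congr rfl fun x _ => by ring
  rw [hS1, hS2]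
  ring

/-- Sums over configurations on `Option ι` = sums over the ghost spin and configurations on `ι`.
[folklore] -/
theorem sum_config_option (F : SpinConfig (Option ι) → ℝ) :
    (∑ σ : SpinConfig (Option ι), F σ) =
      ∑ s : ℤˣ, ∑ ρ : SpinConfig ι, F (fun a => Option.casesOn a s ρ) := by
  rw [← Fintype.sum_prod_type']
  exact Fintype.sum_equiv (Equiv.piOptionEquivProd (β := fun _ => ℤˣ)) _ _ fun σ => by
    congr 1
    funext a; cases a <;> rfl

/-- `Σ_{s = ±1} f(s) = f(1) + f(-1)`. [folklore] -/
theorem sum_units_eq (f : ℤˣ → ℝ) : (∑ s : ℤˣ, f s) = f 1 + f (-1) := by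
  rw [UnitsInt.univ, Finset.sum_insert (by decide), Finset.sum_singleton]

/-- **Ghost dictionary, odd part**: `Σ_{σ̂} F(σ̂|_ι) σ̂_g w_{c'}(σ̂) = 2 Σ_ρ F(ρ) sinh(h·ρ) w_c(ρ)`.
[cite: DuminilCopin2016, §2 (Griffiths' ghost vertex)] -/
theorem sum_mul_spinAt_none_mul_weight_ghost (c : ι → ι → ℝ) (h : ι → ℝ) (F : SpinConfig ι → ℝ) :
    (∑ σ : SpinConfig (Option ι), F (restrictSome σ) * spinAt none σ * weight (ghostCouplings c h) σ) =
      2 * ∑ ρ : SpinConfig ι, F ρ * Real.sinh (∑ x, h x * spinAt x ρ) * weight c ρ := by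
  rw [sum_config_option, sum_units_eq]
  have hw : ∀ (s : ℤˣ) (ρ : SpinConfig ι),
      weight (ghostCouplings c h) (fun a => Option.casesOn a s ρ : SpinConfig (Option ι)) =
        weight c ρ * Real.exp (((s : ℤ) : ℝ) * ∑ x, h x * spinAt x ρ) := by
    intro s ρ; rw [weight_ghostCouplings]; rfl
  have hr : ∀ (s : ℤˣ) (ρ : SpinConfig ι),
      F (restrictSome (fun a => Option.casesOn a s ρ : SpinConfig (Option ι))) = F ρ := fun s ρ => rfl
  have hg : ∀ (s : ℤˣ) (ρ : SpinConfig ι),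
      spinAt none (fun a => Option.casesOn a s ρ : SpinConfig (Option ι)) = ((s : ℤ) : ℝ) := fun s ρ => rfl
  simp_rw [hw, hr, hg]
  simp only [Units.val_one, Int.cast_one, one_mul, mul_one, Units.val_neg, Int.cast_neg, neg_mul]
  rw [Finset.mul_sum, ← Finset.sum_add_distrib]
  refine Finset.sum_congr rfl fun ρ _ => ?_
  rw [Real.sinh_eq]
  ring

/-- **Ghost dictionary, even part**: `Σ_{σ̂} F(σ̂|_ι) w_{c'}(σ̂) = 2 Σ_ρ F(ρ) cosh(h·ρ) w_c(ρ)`.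
[cite: DuminilCopin2016, §2 (Griffiths' ghost vertex)] -/
theorem sum_mul_weight_ghost (c : ι → ι → ℝ) (h : ι → ℝ) (F : SpinConfig ι → ℝ) :
    (∑ σ : SpinConfig (Option ι), F (restrictSome σ) * weight (ghostCouplings c h) σ) =
      2 * ∑ ρ : SpinConfig ι, F ρ * Real.cosh (∑ x, h x * spinAt x ρ) * weight c ρ := by
  rw [sum_config_option, sum_units_eq]
  have hw : ∀ (s : ℤˣ) (ρ : SpinConfig ι),
      weight (ghostCouplings c h) (fun a => Option.casesOn a s ρ : SpinConfig (Option ι)) =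
        weight c ρ * Real.exp (((s : ℤ) : ℝ) * ∑ x, h x * spinAt x ρ) := by
    intro s ρ; rw [weight_ghostCouplings]; rfl
  have hr : ∀ (s : ℤˣ) (ρ : SpinConfig ι),
      F (restrictSome (fun a => Option.casesOn a s ρ : SpinConfig (Option ι))) = F ρ := fun s ρ => rfl
  simp_rw [hw, hr]
  simp only [Units.val_one, Int.cast_one, one_mul, Units.val_neg, Int.cast_neg, neg_mul]
  rw [Finset.mul_sum, ← Finset.sum_add_distrib]
  refine Finset.sum_congr rfl fun ρ _ => ?_
  rw [Real.cosh_eq]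
  ring

/-- **The sub-model off a ghost-free set is again a ghost model**: for `g ∉ B`,
`cSub Bᶜ (ghostCouplings c h) = ghostCouplings (cSub K_B c) (lamSub K_B h)` with
`K_B = {x | some x ∉ B}`. [folklore] -/
theorem cSub_compl_ghostCouplings {B : Finset (Option ι)} (hB : none ∉ B) (c : ι → ι → ℝ) (h : ι → ℝ) :
    cSub Bᶜ (ghostCouplings c h) =
      ghostCouplings (cSub (univ.filter fun x => some x ∉ B) c) (lamSub (univ.filter fun x => some x ∉ B) h) := by
  funext a b
  cases a <;> cases b <;>
    simp [cSub, ghostCouplings, lamSub, hB, Finset.mem_compl, Finset.mem_filter] <;> split_ifs <;> simp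

end Ghost


/-! ### The real-field random-current identity for `⟨σ_uσ_v ; σ_w⟩` with cluster decomposition -/

section RealIdentity

variable {ι : Type*} [Fintype ι] [DecidableEq ι]

/-- `Sh_c[F](h) = Σ_ρ F(ρ) sinh(Σ_x h_x σ_x) w_c(ρ)` (odd part of the field sum). [folklore] -/
def sinhSum (c : ι → ι → ℝ) (h : ι → ℝ) (F : SpinConfig ι → ℝ) : ℝ :=
  ∑ ρ : SpinConfig ι, F ρ * Real.sinh (∑ x, h x * spinAt x ρ) * weight c ρ

/-- `Ch_c[F](h) = Σ_ρ F(ρ) cosh(Σ_x h_x σ_x) w_c(ρ)` (even part of the field sum). [folklore] -/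
def coshSum (c : ι → ι → ℝ) (h : ι → ℝ) (F : SpinConfig ι → ℝ) : ℝ :=
  ∑ ρ : SpinConfig ι, F ρ * Real.cosh (∑ x, h x * spinAt x ρ) * weight c ρ

omit [Fintype ι] in
/-- `σ_{{a} Δ {b}} = σ_a σ_b`. [folklore] -/
theorem spinProduct_symmDiff_singletons (a b : ι) (σ : SpinConfig ι) :
    spinProduct ({a} ∆ {b}) σ = spinAt a σ * spinAt b σ :=
  (congrFun (spinPair_eq_spinProduct_symmDiff a b) σ).symm

/-- `Zs'[({u'}Δ{v'})Δ({w'}Δ{g})] = 2 Sh_c[σ_uσ_vσ_w]`. [folklore] -/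
theorem ghost_sum_T0 (c : ι → ι → ℝ) (h : ι → ℝ) (u v w : ι) :
    (∑ σ : SpinConfig (Option ι), spinProduct (({some u} ∆ {some v}) ∆ ({some w} ∆ {none})) σ *
        weight (ghostCouplings c h) σ) =
      2 * sinhSum c h (fun ρ => spinAt u ρ * spinAt v ρ * spinAt w ρ) := by
  rw [sinhSum, ← sum_mul_spinAt_none_mul_weight_ghost c h (fun ρ => spinAt u ρ * spinAt v ρ * spinAt w ρ)]
  refine Finset.sum_congr rfl fun σ _ => ?_
  rw [← spinProduct_mul_spinProduct, spinProduct_symmDiff_singletons, spinProduct_symmDiff_singletons]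
  simp only [spinAt_restrictSome]
  ring

/-- `Zs'[∅] = 2 Ch_c[1]`. [folklore] -/
theorem ghost_sum_empty (c : ι → ι → ℝ) (h : ι → ℝ) :
    (∑ σ : SpinConfig (Option ι), spinProduct ∅ σ * weight (ghostCouplings c h) σ) =
      2 * coshSum c h (fun _ => 1) := by
  rw [coshSum, ← sum_mul_weight_ghost c h (fun _ => 1)]
  simp [spinProduct_empty]

/-- `Zs'[{u'}Δ{v'}] = 2 Ch_c[σ_uσ_v]`. [folklore] -/
theorem ghost_sum_pair (c : ι → ι → ℝ) (h : ι → ℝ) (u v : ι) :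
    (∑ σ : SpinConfig (Option ι), spinProduct ({some u} ∆ {some v}) σ * weight (ghostCouplings c h) σ) =
      2 * coshSum c h (fun ρ => spinAt u ρ * spinAt v ρ) := by
  rw [coshSum, ← sum_mul_weight_ghost c h (fun ρ => spinAt u ρ * spinAt v ρ)]
  refine Finset.sum_congr rfl fun σ _ => ?_
  rw [spinProduct_symmDiff_singletons]
  simp only [spinAt_restrictSome]

/-- `Zs'[{w'}Δ{g}] = 2 Sh_c[σ_w]`. [folklore] -/
theorem ghost_sum_single (c : ι → ι → ℝ) (h : ι → ℝ) (w : ι) :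
    (∑ σ : SpinConfig (Option ι), spinProduct ({some w} ∆ {none}) σ * weight (ghostCouplings c h) σ) =
      2 * sinhSum c h (fun ρ => spinAt w ρ) := by
  rw [sinhSum, ← sum_mul_spinAt_none_mul_weight_ghost c h (fun ρ => spinAt w ρ)]
  refine Finset.sum_congr rfl fun σ _ => ?_
  rw [spinProduct_symmDiff_singletons]
  simp only [spinAt_restrictSome]

/-- `Zs'[{a', g}] = 2 Sh_c[σ_a]`. [folklore] -/
theorem ghost_sum_pair_none (c : ι → ι → ℝ) (h : ι → ℝ) (a : ι) :
    (∑ σ : SpinConfig (Option ι), spinProduct {some a, none} σ * weight (ghostCouplings c h) σ) =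
      2 * sinhSum c h (fun ρ => spinAt a ρ) := by
  rw [sinhSum, ← sum_mul_spinAt_none_mul_weight_ghost c h (fun ρ => spinAt a ρ)]
  refine Finset.sum_congr rfl fun σ _ => ?_
  rw [spinProduct, Finset.prod_pair (Option.some_ne_none a)]
  simp only [spinAt_restrictSome]

omit [Fintype ι] in
/-- **Parity of the outer sources.** For `T₀ = ({u'}Δ{v'})Δ({w'}Δ{g})`, `g ∉ B ∋ w'`: unless
`T₀ ∖ B = {a', g}` for some site `a`, the set `T₀ ∖ B` has odd cardinality. [folklore] -/
theorem odd_card_sdiff_of_not_exists (u v w : ι) {B : Finset (Option ι)} (hgB : none ∉ B)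
    (hwB : some w ∈ B)
    (hex : ¬∃ a : ι, (({some u} ∆ {some v}) ∆ ({some w} ∆ {none})) \ B = {some a, none}) :
    Odd #((({some u} ∆ {some v}) ∆ ({some w} ∆ {none})) \ B) := by
  set S := (({some u} ∆ {some v}) ∆ ({some w} ∆ {none}) : Finset (Option ι)) \ B with hS
  have hgS : none ∈ S := by
    rw [hS, Finset.mem_sdiff]
    refine ⟨?_, hgB⟩
    simp [Finset.mem_symmDiff]
  have hsub : S.erase none ⊆ {some u, some v} := by
    intro x hx
    rw [Finset.mem_erase, hS, Finset.mem_sdiff] at hx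
    obtain ⟨hxg, hxT, hxB⟩ := hx
    have hxw : x ≠ some w := fun h => hxB (h ▸ hwB)
    simp only [Finset.mem_symmDiff, Finset.mem_singleton] at hxT
    simp only [Finset.mem_insert, Finset.mem_singleton]
    tauto
  have hcard : #S = #(S.erase none) + 1 := (Finset.card_erase_add_one hgS).symm
  have hle : #(S.erase none) ≤ 2 := (Finset.card_le_card hsub).trans Finset.card_le_two
  by_contra hnot
  rw [Nat.not_odd_iff_even] at hnot
  have h1 : #(S.erase none) = 1 := by
    rcases hnot with ⟨k, hk⟩
    have hne : #(S.erase none) ≠ 0 := by omega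
    have hne2 : #(S.erase none) ≠ 2 := by omega
    omega
  obtain ⟨a₀, ha₀⟩ := Finset.card_eq_one.1 h1
  have ha₀mem : a₀ ∈ ({some u, some v} : Finset (Option ι)) := hsub (by rw [ha₀]; simp)
  obtain ⟨a, rfl⟩ : ∃ a, a₀ = some a := by
    simp only [Finset.mem_insert, Finset.mem_singleton] at ha₀mem
    rcases ha₀mem with h | h
    exacts [⟨u, h⟩, ⟨v, h⟩]
  apply hex
  refine ⟨a, ?_⟩
  rw [← Finset.insert_erase hgS, ha₀]
  exact Finset.pair_comm _ _

/-- The inner masses of the ghost model do not see the fields (no edge inside a ghost-free `B` is a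
ghost edge). [folklore] -/
theorem innerMass_ghost_eq {B : Finset (Option ι)} (hB : none ∉ B) (c : ι → ι → ℝ) (h h' : ι → ℝ)
    (s : Option ι) (S : Finset (Option ι)) :
    Current.innerMass (edgeK (ghostCouplings c h)) s B S =
      Current.innerMass (edgeK (ghostCouplings c h')) s B S := by
  refine Current.innerMass_congr (fun e he => ?_) s S
  obtain ⟨e, hemem⟩ := e
  induction e using Sym2.ind with
  | _ a b =>
    have ha : a ∈ B := he a (Sym2.mem_mk_left a b)
    have hb : b ∈ B := he b (Sym2.mem_mk_right a b)
    rcases a with _ | x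
    · exact absurd ha hB
    rcases b with _ | y
    · exact absurd hb hB
    change pairEdgeWeight _ 2 ⟨s(some x, some y), hemem⟩ = pairEdgeWeight _ 2 ⟨s(some x, some y), hemem⟩
    rw [pairEdgeWeight_apply_mk, pairEdgeWeight_apply_mk]
    rfl

/-- **Step 1 (switching, spin-sum form).**
`4 (Sh[σuσvσw] Ch[1] − Ch[σuσv] Sh[σw]) = R² · D_{w',g}(T₀)` with `R = e^{tr c} 2^{|ι|+1}`.
[cite: DuminilCopin2016, §2–§3 (ghost vertex; Lemma 3.1, switching; Griffiths' second inequality after Prop. 3.3)] -/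
theorem four_mul_truncated_eq {c : ι → ι → ℝ} (hc : ∀ a b, 0 ≤ c a b) {h : ι → ℝ} (hh : ∀ x, 0 ≤ h x)
    (u v w : ι) :
    4 * (sinhSum c h (fun ρ => spinAt u ρ * spinAt v ρ * spinAt w ρ) * coshSum c h (fun _ => 1) -
        coshSum c h (fun ρ => spinAt u ρ * spinAt v ρ) * sinhSum c h (fun ρ => spinAt w ρ)) =
      (Real.exp (∑ x, c x x) * 2 ^ Fintype.card (Option ι)) ^ 2 *
        (Current.dmass (edgeK (ghostCouplings c h)) (some w) none
          (({some u} ∆ {some v}) ∆ ({some w} ∆ {none}))).toReal := by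
  have hc' := ghostCouplings_nonneg hc hh
  have hZs : ∀ A : Finset (Option ι), (∑ σ, spinProduct A σ * weight (ghostCouplings c h) σ) =
      Real.exp (∑ x, c x x) * 2 ^ Fintype.card (Option ι) *
        wcurrentSum (edgeK (ghostCouplings c h)) A := by
    intro A; rw [sum_spinProduct_weight_eq hc' A, sum_ghostCouplings_diag]
  rw [Current.toReal_dmass (edgeK_nonneg hc') (some w) none, symmDiff_symmDiff_cancel_right]
  have e1 := hZs (({some u} ∆ {some v}) ∆ ({some w} ∆ {none})); rw [ghost_sum_T0] at e1
  have e2 := hZs ∅; rw [ghost_sum_empty] at e2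
  have e3 := hZs ({some u} ∆ {some v}); rw [ghost_sum_pair] at e3
  have e4 := hZs ({some w} ∆ {none}); rw [ghost_sum_single] at e4
  set R := Real.exp (∑ x, c x x) * 2 ^ Fintype.card (Option ι)
  set K := edgeK (ghostCouplings c h)
  linear_combination (2 * coshSum c h (fun _ => 1)) * e1 +
    (R * wcurrentSum K (({some u} ∆ {some v}) ∆ ({some w} ∆ {none}))) * e2 -
    (2 * sinhSum c h (fun ρ => spinAt w ρ)) * e3 - (R * wcurrentSum K ({some u} ∆ {some v})) * e4

/-- **Step 2 (cluster decomposition, real form, field-free inner masses).** [cite: AizenmanCMP1982, §5 (conditioning on clusters)] -/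
theorem toReal_dmass_ghost {c : ι → ι → ℝ} (hc : ∀ a b, 0 ≤ c a b) {h : ι → ℝ} (hh : ∀ x, 0 ≤ h x)
    (s : Option ι) (T : Finset (Option ι)) :
    (Current.dmass (edgeK (ghostCouplings c h)) s none T).toReal =
      ∑ B : Finset (Option ι), (if none ∈ B then (0 : ℝ) else 1) *
        (Current.innerMass (edgeK (ghostCouplings c fun _ => 0)) s B (T ∩ B)).toReal *
        (wcurrentSum (cutCoupling (edgeK (ghostCouplings c h)) B) (T \ B) *
          wcurrentSum (cutCoupling (edgeK (ghostCouplings c h)) B) ∅) := by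
  have hK : ∀ e, 0 ≤ edgeK (ghostCouplings c h) e := edgeK_nonneg (ghostCouplings_nonneg hc hh)
  have hdec : Current.dmass (edgeK (ghostCouplings c h)) s none T =
      ∑ B : Finset (Option ι), (if none ∈ B then 0 else 1) *
        Current.innerMass (edgeK (ghostCouplings c fun _ => 0)) s B (T ∩ B) *
        (ecurrentSum (cutCoupling (edgeK (ghostCouplings c h)) B) (T \ B) *
          ecurrentSum (cutCoupling (edgeK (ghostCouplings c h)) B) ∅) := by
    rw [Current.dmass_eq_sum_innerMass hK s none T]
    refine Finset.sum_congr rfl fun B _ => ?_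
    by_cases hB : none ∈ B
    · simp [hB]
    · rw [innerMass_ghost_eq hB c h (fun _ => 0)]
  have hne : ∀ B : Finset (Option ι), (if none ∈ B then (0 : ℝ≥0∞) else 1) *
      Current.innerMass (edgeK (ghostCouplings c fun _ => 0)) s B (T ∩ B) *
      (ecurrentSum (cutCoupling (edgeK (ghostCouplings c h)) B) (T \ B) *
        ecurrentSum (cutCoupling (edgeK (ghostCouplings c h)) B) ∅) ≠ ⊤ := by
    intro B
    refine ne_top_of_le_ne_top (Current.dmass_ne_top hK s none T) ?_
    rw [hdec]
    exact Finset.single_le_sum_of_canonicallyOrdered (M := ℝ≥0∞) (Finset.mem_univ B)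
  rw [hdec, ENNReal.toReal_sum (fun B _ => hne B)]
  refine Finset.sum_congr rfl fun B _ => ?_
  rw [ENNReal.toReal_mul, ENNReal.toReal_mul, ENNReal.toReal_mul,
    toReal_ecurrentSum (cutCoupling_nonneg hK B), toReal_ecurrentSum (cutCoupling_nonneg hK B)]
  congr 2
  split_ifs <;> simp

/-- **Step 3 (the outer factors as field sums of the sub-model; parity).** For each `B`:
`R²·[g∉B]·I_B·Z_B[T₀∖B]·Z_B[∅] = Σ_a [g∉B, T₀∖B={a',g}] (R²/R_B²) I_B · 4 Sh_{K_B}[σ_a] Ch_{K_B}[1]`.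
[cite: AizenmanCMP1982, §5 (conditioning on clusters)] -/
theorem termB_eq {c : ι → ι → ℝ} (hc : ∀ a b, 0 ≤ c a b) {h : ι → ℝ} (hh : ∀ x, 0 ≤ h x)
    (u v w : ι) (B : Finset (Option ι)) (R : ℝ) :
    R ^ 2 * ((if none ∈ B then (0 : ℝ) else 1) *
      (Current.innerMass (edgeK (ghostCouplings c fun _ => 0)) (some w) B
        ((({some u} ∆ {some v}) ∆ ({some w} ∆ {none})) ∩ B)).toReal *
      (wcurrentSum (cutCoupling (edgeK (ghostCouplings c h)) B)
          ((({some u} ∆ {some v}) ∆ ({some w} ∆ {none})) \ B) *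
        wcurrentSum (cutCoupling (edgeK (ghostCouplings c h)) B) ∅)) =
    ∑ a : ι, (if none ∉ B ∧ (({some u} ∆ {some v}) ∆ ({some w} ∆ {none})) \ B = {some a, none} then
        R ^ 2 / (Real.exp (∑ x, cSub (univ.filter fun x => some x ∉ B) c x x) *
          2 ^ Fintype.card (Option ι)) ^ 2 *
        (Current.innerMass (edgeK (ghostCouplings c fun _ => 0)) (some w) B
          ((({some u} ∆ {some v}) ∆ ({some w} ∆ {none})) ∩ B)).toReal else 0) *
      (4 * (sinhSum (cSub (univ.filter fun x => some x ∉ B) c) (lamSub (univ.filter fun x => some x ∉ B) h)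
          (fun ρ => spinAt a ρ) *
        coshSum (cSub (univ.filter fun x => some x ∉ B) c) (lamSub (univ.filter fun x => some x ∉ B) h)
          (fun _ => 1))) := by
  set T₀ := (({some u} ∆ {some v}) ∆ ({some w} ∆ {none}) : Finset (Option ι)) with hT₀
  set KB := univ.filter fun x => some x ∉ B with hKB
  set I := (Current.innerMass (edgeK (ghostCouplings c fun _ => 0)) (some w) B (T₀ ∩ B)).toReal with hI
  set RB := Real.exp (∑ x, cSub KB c x x) * 2 ^ Fintype.card (Option ι) with hRB
  by_cases hgB : none ∈ B
  · simp [hgB]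
  rw [if_neg hgB, one_mul]
  have hK : ∀ e, 0 ≤ edgeK (ghostCouplings c h) e := edgeK_nonneg (ghostCouplings_nonneg hc hh)
  have hcut : cutCoupling (edgeK (ghostCouplings c h)) B = edgeK (ghostCouplings (cSub KB c) (lamSub KB h)) := by
    rw [cutCoupling_edgeK, cSub_compl_ghostCouplings hgB]
  have hcBnn : ∀ a b, 0 ≤ ghostCouplings (cSub KB c) (lamSub KB h) a b :=
    ghostCouplings_nonneg (cSub_nonneg _ hc) (lamSub_nonneg _ hh)
  have hZsB : ∀ A : Finset (Option ι),
      (∑ σ, spinProduct A σ * weight (ghostCouplings (cSub KB c) (lamSub KB h)) σ) =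
        RB * wcurrentSum (cutCoupling (edgeK (ghostCouplings c h)) B) A := by
    intro A
    rw [hcut, sum_spinProduct_weight_eq hcBnn A, sum_ghostCouplings_diag]
  have hRBpos : 0 < RB := by positivity
  have hZ0 : wcurrentSum (cutCoupling (edgeK (ghostCouplings c h)) B) ∅ =
      2 * coshSum (cSub KB c) (lamSub KB h) (fun _ => 1) / RB := by
    rw [eq_div_iff hRBpos.ne', mul_comm, ← hZsB ∅, ghost_sum_empty]
  by_cases hex : ∃ a : ι, T₀ \ B = {some a, none}
  · obtain ⟨a, ha⟩ := hex
    rw [Finset.sum_eq_single a]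
    · rw [if_pos ⟨hgB, ha⟩, ha]
      have hZa : wcurrentSum (cutCoupling (edgeK (ghostCouplings c h)) B) {some a, none} =
          2 * sinhSum (cSub KB c) (lamSub KB h) (fun ρ => spinAt a ρ) / RB := by
        rw [eq_div_iff hRBpos.ne', mul_comm, ← hZsB, ghost_sum_pair_none]
      rw [hZa, hZ0]
      field_simp
      ring
    · intro b _ hba
      rw [if_neg, zero_mul]
      rintro ⟨-, hb⟩
      apply hba
      rw [ha] at hb
      have hmem : some b ∈ ({some a, none} : Finset (Option ι)) := by rw [hb]; simp
      simp only [Finset.mem_insert, Finset.mem_singleton, Option.some.injEq, reduceCtorEq, or_false] at hmem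
      exact hmem
    · intro hna; exact absurd (Finset.mem_univ a) hna
  · have hzero : ∀ a : ι, (if none ∉ B ∧ T₀ \ B = {some a, none} then R ^ 2 / RB ^ 2 * I else 0) = 0 :=
      fun a => if_neg fun h' => hex ⟨a, h'.2⟩
    simp only [hzero, zero_mul, Finset.sum_const_zero]
    by_cases hwB : some w ∈ B
    · have hodd : Odd #(T₀ \ B) := odd_card_sdiff_of_not_exists u v w hgB hwB hex
      rw [hcut, wcurrentSum_edgeK_eq_zero_of_odd hcBnn hodd]
      ring
    · have hI0 : I = 0 := by
        rw [hI, Current.innerMass_eq_zero_of_not_mem _ hwB, ENNReal.toReal_zero]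
      rw [hI0]
      ring

/-- **The random-current identity for `⟨σ_uσ_v ; σ_w⟩` at real fields, with cluster decomposition**
(GHS/Aizenman switching lemma with a ghost spin + conditioning on the cluster of `w`): there are
`κ_{K,a} ≥ 0`, INDEPENDENT OF THE FIELDS, such that for all `h ≥ 0`
`Sh_c[σuσvσw](h) Ch_c[1](h) − Ch_c[σuσv](h) Sh_c[σw](h) = Σ_{K,a} κ_{K,a} Sh_{c|K}[σ_a](h|K) Ch_{c|K}[1](h|K)`,
where `c|K = cSub K c`, `h|K = lamSub K h` is the induced sub-model on `K ⊆ ι` (`K` = complement of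
the cluster of `w`, `a` = the one of `u, v` outside it). [cite: AizenmanCMP1982, §5 (conditioning on clusters; switching lemma with Griffiths' ghost vertex as in DuminilCopin2016 §2–§3)] -/
theorem exists_kappa_truncated_pair_field {c : ι → ι → ℝ} (hc : ∀ a b, 0 ≤ c a b) (u v w : ι) :
    ∃ κ : Finset ι → ι → ℝ, (∀ K a, 0 ≤ κ K a) ∧ ∀ h : ι → ℝ, (∀ x, 0 ≤ h x) →
      sinhSum c h (fun ρ => spinAt u ρ * spinAt v ρ * spinAt w ρ) * coshSum c h (fun _ => 1) -
          coshSum c h (fun ρ => spinAt u ρ * spinAt v ρ) * sinhSum c h (fun ρ => spinAt w ρ) =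
        ∑ K : Finset ι, ∑ a : ι, κ K a *
          (sinhSum (cSub K c) (lamSub K h) (fun ρ => spinAt a ρ) *
            coshSum (cSub K c) (lamSub K h) (fun _ => 1)) := by
  set T₀ := (({some u} ∆ {some v}) ∆ ({some w} ∆ {none}) : Finset (Option ι)) with hT₀
  set R : ℝ := Real.exp (∑ x, c x x) * 2 ^ Fintype.card (Option ι) with hR
  -- the field-free coefficients
  set coef : Finset (Option ι) → ℝ := fun B =>
    R ^ 2 / (Real.exp (∑ x, cSub (univ.filter fun x => some x ∉ B) c x x) *
      2 ^ Fintype.card (Option ι)) ^ 2 *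
    (Current.innerMass (edgeK (ghostCouplings c fun _ => 0)) (some w) B (T₀ ∩ B)).toReal with hcoef
  refine ⟨fun K a => ∑ B : Finset (Option ι),
      if none ∉ B ∧ (univ.filter fun x => some x ∉ B) = K ∧ T₀ \ B = {some a, none} then coef B else 0,
    ?_, ?_⟩
  · intro K a
    refine Finset.sum_nonneg fun B _ => ?_
    split_ifs
    · exact mul_nonneg (div_nonneg (sq_nonneg _) (sq_nonneg _)) ENNReal.toReal_nonneg
    · exact le_rfl
  intro h hh
  set P : Finset ι → ι → ℝ := fun K a =>
    sinhSum (cSub K c) (lamSub K h) (fun ρ => spinAt a ρ) * coshSum (cSub K c) (lamSub K h) (fun _ => 1)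
    with hP
  have h4 := four_mul_truncated_eq hc hh u v w
  rw [toReal_dmass_ghost hc hh (some w) T₀, Finset.mul_sum] at h4
  have hterm : ∀ B : Finset (Option ι),
      R ^ 2 * ((if none ∈ B then (0 : ℝ) else 1) *
        (Current.innerMass (edgeK (ghostCouplings c fun _ => 0)) (some w) B (T₀ ∩ B)).toReal *
        (wcurrentSum (cutCoupling (edgeK (ghostCouplings c h)) B) (T₀ \ B) *
          wcurrentSum (cutCoupling (edgeK (ghostCouplings c h)) B) ∅)) =
      ∑ a : ι, (if none ∉ B ∧ T₀ \ B = {some a, none} then coef B else 0) *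
        (4 * P (univ.filter fun x => some x ∉ B) a) := fun B => termB_eq hc hh u v w B R
  simp only [← hR] at h4
  simp only [hterm] at h4
  -- insert the sum over `K`
  have hins : ∀ (B : Finset (Option ι)) (a : ι),
      (if none ∉ B ∧ T₀ \ B = {some a, none} then coef B else 0) * (4 * P (univ.filter fun x => some x ∉ B) a) =
        ∑ K : Finset ι, (if none ∉ B ∧ (univ.filter fun x => some x ∉ B) = K ∧ T₀ \ B = {some a, none}
          then coef B else 0) * (4 * P K a) := by
    intro B a
    rw [Finset.sum_eq_single (univ.filter fun x => some x ∉ B)]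
    · by_cases h1 : none ∉ B ∧ T₀ \ B = {some a, none}
      · rw [if_pos h1, if_pos ⟨h1.1, rfl, h1.2⟩]
      · rw [if_neg h1, if_neg (fun h' => h1 ⟨h'.1, h'.2.2⟩)]
    · intro K _ hK
      rw [if_neg (fun h' => hK h'.2.1.symm), zero_mul]
    · intro hna; exact absurd (Finset.mem_univ _) hna
  simp only [hins] at h4
  -- reorder the sums
  have hre : (∑ B : Finset (Option ι), ∑ a : ι, ∑ K : Finset ι,
      (if none ∉ B ∧ (univ.filter fun x => some x ∉ B) = K ∧ T₀ \ B = {some a, none} then coef B else 0) *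
        (4 * P K a)) =
      4 * ∑ K : Finset ι, ∑ a : ι, (∑ B : Finset (Option ι),
        (if none ∉ B ∧ (univ.filter fun x => some x ∉ B) = K ∧ T₀ \ B = {some a, none} then coef B else 0)) *
          P K a := by
    rw [Finset.sum_comm]
    simp_rw [Finset.sum_comm (s := (univ : Finset (Finset (Option ι)))) (t := (univ : Finset (Finset ι)))]
    rw [Finset.sum_comm, Finset.mul_sum]
    refine Finset.sum_congr rfl fun K _ => ?_
    rw [Finset.mul_sum]
    refine Finset.sum_congr rfl fun a _ => ?_
    rw [Finset.sum_mul, Finset.mul_sum]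
    refine Finset.sum_congr rfl fun B _ => ?_
    ring
  rw [hre] at h4
  have h4' := mul_left_cancel₀ (four_ne_zero : (4 : ℝ) ≠ 0) h4
  rw [h4']

end RealIdentity


/-! ### Complexification: the identity at imaginary fields `h = iθλ` -/

section Complex

open Complex

variable {ι : Type*} [Fintype ι] [DecidableEq ι]

/-- Complex-field version of `sinhSum`. [folklore] -/
def sinhSumC (c : ι → ι → ℝ) (h : ι → ℂ) (F : SpinConfig ι → ℝ) : ℂ :=
  ∑ ρ : SpinConfig ι, (F ρ : ℂ) * Complex.sinh (∑ x, h x * (spinAt x ρ : ℂ)) * (weight c ρ : ℂ)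

/-- Complex-field version of `coshSum`. [folklore] -/
def coshSumC (c : ι → ι → ℝ) (h : ι → ℂ) (F : SpinConfig ι → ℝ) : ℂ :=
  ∑ ρ : SpinConfig ι, (F ρ : ℂ) * Complex.cosh (∑ x, h x * (spinAt x ρ : ℂ)) * (weight c ρ : ℂ)

/-- Complex fields restricted to `K`. [folklore] -/
def maskC (K : Finset ι) (h : ι → ℂ) : ι → ℂ := fun x => if x ∈ K then h x else 0

/-- At real fields `ShC = Sh`. [folklore] -/
theorem sinhSumC_ofReal (c : ι → ι → ℝ) (h : ι → ℝ) (F : SpinConfig ι → ℝ) :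
    sinhSumC c (fun x => (h x : ℂ)) F = (sinhSum c h F : ℂ) := by
  unfold sinhSumC sinhSum; push_cast; rfl

/-- At real fields `ChC = Ch`. [folklore] -/
theorem coshSumC_ofReal (c : ι → ι → ℝ) (h : ι → ℝ) (F : SpinConfig ι → ℝ) :
    coshSumC c (fun x => (h x : ℂ)) F = (coshSum c h F : ℂ) := by
  unfold coshSumC coshSum; push_cast; rfl

omit [Fintype ι] in
/-- At real fields the mask is `lamSub`. [folklore] -/
theorem maskC_ofReal (K : Finset ι) (h : ι → ℝ) :
    maskC K (fun x => (h x : ℂ)) = fun x => ((lamSub K h x : ℝ) : ℂ) := by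
  funext x; unfold maskC lamSub; split_ifs <;> simp

omit [Fintype ι] in
/-- At the imaginary fields `iθλ` the mask is `iθ·lamSub K λ`. [folklore] -/
theorem maskC_imag (K : Finset ι) (lam : ι → ℝ) (θ : ℝ) :
    maskC K (fun x => I * (θ : ℂ) * (lam x : ℂ)) = fun x => I * (θ : ℂ) * ((lamSub K lam x : ℝ) : ℂ) := by
  funext x; unfold maskC lamSub; split_ifs <;> simp

/-- Coordinatewise-entire fields give entire sums. [folklore] -/
theorem differentiable_sinhSumC (c : ι → ι → ℝ) (F : SpinConfig ι → ℝ) {e : ι → ℂ → ℂ}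
    (he : ∀ x, Differentiable ℂ (e x)) :
    Differentiable ℂ fun z => sinhSumC c (fun x => e x z) F := by
  unfold sinhSumC
  refine Differentiable.fun_sum fun ρ _ => ?_
  refine ((differentiable_const _).mul ?_).mul (differentiable_const _)
  refine Complex.differentiable_sinh.comp ?_
  exact Differentiable.fun_sum fun x _ => (he x).mul (differentiable_const _)

/-- Coordinatewise-entire fields give entire sums (cosh part). [folklore] -/
theorem differentiable_coshSumC (c : ι → ι → ℝ) (F : SpinConfig ι → ℝ) {e : ι → ℂ → ℂ}
    (he : ∀ x, Differentiable ℂ (e x)) :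
    Differentiable ℂ fun z => coshSumC c (fun x => e x z) F := by
  unfold coshSumC
  refine Differentiable.fun_sum fun ρ _ => ?_
  refine ((differentiable_const _).mul ?_).mul (differentiable_const _)
  refine Complex.differentiable_cosh.comp ?_
  exact Differentiable.fun_sum fun x _ => (he x).mul (differentiable_const _)

omit [Fintype ι] in
/-- `z ↦ update h x₀ z x` is entire. [folklore] -/
theorem differentiable_update_apply (h : ι → ℂ) (x₀ x : ι) :
    Differentiable ℂ fun z : ℂ => Function.update h x₀ z x := by
  by_cases hx : x = x₀
  · subst hx; simp only [Function.update_self]; exact differentiable_id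
  · simp only [Function.update_of_ne hx]; exact differentiable_const _

omit [Fintype ι] in
/-- `z ↦ maskC K (update h x₀ z) x` is entire. [folklore] -/
theorem differentiable_maskC_update_apply (K : Finset ι) (h : ι → ℂ) (x₀ x : ι) :
    Differentiable ℂ fun z : ℂ => maskC K (Function.update h x₀ z) x := by
  unfold maskC
  by_cases hK : x ∈ K
  · simp only [if_pos hK]; exact differentiable_update_apply h x₀ x
  · simp only [if_neg hK]; exact differentiable_const _

omit [DecidableEq ι] in
/-- At the imaginary fields `h_x = iθλ_x` the exponent is `iθX`. [folklore] -/
theorem sum_imagField_mul_spin (lam : ι → ℝ) (θ : ℝ) (ρ : SpinConfig ι) :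
    (∑ x, (I * (θ : ℂ) * (lam x : ℂ)) * (spinAt x ρ : ℂ)) =
      ((θ * weightedMagnetization lam ρ : ℝ) : ℂ) * I := by
  unfold weightedMagnetization
  push_cast
  rw [mul_sum, sum_mul]
  exact sum_congr rfl fun x _ => by ring

/-- `ShC_c[F](iθλ) = i Σ F sin(θX) w`. [folklore] -/
theorem sinhSumC_imag (c : ι → ι → ℝ) (lam : ι → ℝ) (θ : ℝ) (F : SpinConfig ι → ℝ) :
    sinhSumC c (fun x => I * (θ : ℂ) * (lam x : ℂ)) F =
      ((∑ ρ : SpinConfig ι, F ρ * Real.sin (θ * weightedMagnetization lam ρ) * weight c ρ : ℝ) : ℂ) * I := by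
  unfold sinhSumC
  simp_rw [sum_imagField_mul_spin lam θ, Complex.sinh_mul_I]
  push_cast
  rw [Finset.sum_mul]
  exact Finset.sum_congr rfl fun ρ _ => by ring

/-- `ChC_c[F](iθλ) = Σ F cos(θX) w`. [folklore] -/
theorem coshSumC_imag (c : ι → ι → ℝ) (lam : ι → ℝ) (θ : ℝ) (F : SpinConfig ι → ℝ) :
    coshSumC c (fun x => I * (θ : ℂ) * (lam x : ℂ)) F =
      ((∑ ρ : SpinConfig ι, F ρ * Real.cos (θ * weightedMagnetization lam ρ) * weight c ρ : ℝ) : ℂ) := by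
  unfold coshSumC
  simp_rw [sum_imagField_mul_spin lam θ, Complex.cosh_mul_I]
  push_cast
  rfl

/-- **Identity principle on the non-negative orthant.** Two functions `f, g : (ι → ℂ) → ℂ` on finitely
many complex variables which are entire in each coordinate separately and agree at all points with
real non-negative coordinates agree everywhere (one-variable identity theorem, coordinate by
coordinate). [folklore] -/
theorem eq_of_eqOn_nonneg_orthant {f g : (ι → ℂ) → ℂ}
    (hf : ∀ (h : ι → ℂ) (x₀ : ι), Differentiable ℂ fun z : ℂ => f (Function.update h x₀ z))
    (hg : ∀ (h : ι → ℂ) (x₀ : ι), Differentiable ℂ fun z : ℂ => g (Function.update h x₀ z))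
    (hfg : ∀ h : ι → ℝ, (∀ x, 0 ≤ h x) → f (fun x => (h x : ℂ)) = g (fun x => (h x : ℂ))) :
    f = g := by
  -- `P T`: agreement when the coordinates off `T` are real and non-negative
  suffices key : ∀ T : Finset ι, ∀ h : ι → ℂ,
      (∀ x, x ∉ T → (h x).im = 0 ∧ 0 ≤ (h x).re) → f h = g h by
    funext h
    exact key Finset.univ h fun x hx => absurd (Finset.mem_univ x) hx
  intro T
  induction T using Finset.induction_on with
  | empty =>
    intro h hh
    have hreal : h = fun x => (((h x).re : ℝ) : ℂ) := by
      funext x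
      obtain ⟨him, -⟩ := hh x (Finset.notMem_empty x)
      exact Complex.ext (by simp) (by simp [him])
    rw [hreal]
    exact hfg (fun x => (h x).re) fun x => (hh x (Finset.notMem_empty x)).2
  | insert x₀ T hx₀ ih =>
    intro h hh
    set φ : ℂ → ℂ := fun z => f (Function.update h x₀ z) with hφ
    set ψ : ℂ → ℂ := fun z => g (Function.update h x₀ z) with hψ
    have hφa : AnalyticOnNhd ℂ φ Set.univ := analyticOnNhd_univ_iff_differentiable.2 (hf h x₀)
    have hψa : AnalyticOnNhd ℂ ψ Set.univ := analyticOnNhd_univ_iff_differentiable.2 (hg h x₀)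
    have hagree : ∀ r : ℝ, 0 ≤ r → φ (r : ℂ) = ψ (r : ℂ) := by
      intro r hr
      simp only [hφ, hψ]
      refine ih (Function.update h x₀ (r : ℂ)) fun x hx => ?_
      by_cases hxx : x = x₀
      · subst hxx
        rw [Function.update_self]
        exact ⟨Complex.ofReal_im r, by rwa [Complex.ofReal_re]⟩
      · rw [Function.update_of_ne hxx]
        exact hh x (by simp [hxx, hx])
    set uu : ℕ → ℂ := fun n => (((1 : ℝ) + 1 / ((n : ℝ) + 1) : ℝ) : ℂ) with hu
    have hseq : Filter.Tendsto uu Filter.atTop (nhdsWithin (1 : ℂ) {(1 : ℂ)}ᶜ) := by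
      refine tendsto_nhdsWithin_iff.2 ⟨?_, ?_⟩
      · have h1 : Filter.Tendsto (fun n : ℕ => (1 : ℝ) + 1 / ((n : ℝ) + 1)) Filter.atTop (nhds 1) := by
          have := (tendsto_one_div_add_atTop_nhds_zero_nat).const_add (1 : ℝ)
          rwa [add_zero] at this
        have h2 := (Complex.continuous_ofReal.tendsto 1).comp h1
        rwa [Complex.ofReal_one] at h2
      · refine Filter.Eventually.of_forall fun n => ?_
        simp only [Set.mem_compl_iff, Set.mem_singleton_iff, hu]
        rw [show (1 : ℂ) = ((1 : ℝ) : ℂ) from Complex.ofReal_one.symm, Complex.ofReal_inj]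
        have : (0 : ℝ) < 1 / ((n : ℝ) + 1) := by positivity
        linarith
    have hfreq : ∃ᶠ z in nhdsWithin (1 : ℂ) {(1 : ℂ)}ᶜ, φ z = ψ z := by
      refine hseq.frequently (Filter.Frequently.of_forall fun n => ?_)
      exact hagree _ (by positivity)
    have hφψ : φ = ψ := AnalyticOnNhd.eq_of_frequently_eq hφa hψa hfreq
    have := congrFun hφψ (h x₀)
    simpa [hφ, hψ] using this

/-- **The random-current identity (RC) at imaginary fields**, in the form consumed by
`CamiaJiangNewman2023_thm2_of_rc`: for `c, λ ≥ 0` there are `κ_{K,a} ≥ 0` with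
`S_{uvw}(θ) Z(θ) − N_{uv}(θ) S_w(θ) = Σ_{K,a} κ_{K,a} S^K_a(θ) Z_K(θ)` for all real `θ`
(real-field identity `exists_kappa_truncated_pair_field` + analytic continuation in the fields).
[cite: AizenmanCMP1982, §5 (conditioning on clusters; switching lemma with Griffiths' ghost vertex as in DuminilCopin2016 §2–§3)] -/
theorem rc_imaginary_field (c : ι → ι → ℝ) (lam : ι → ℝ) (u v w : ι) (hc : ∀ a b, 0 ≤ c a b) :
    ∃ κ : Finset ι → ι → ℝ, (∀ K a, 0 ≤ κ K a) ∧ ∀ θ : ℝ,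
      (∑ ρ : SpinConfig ι, spinAt u ρ * spinAt v ρ * spinAt w ρ *
            Real.sin (θ * weightedMagnetization lam ρ) * weight c ρ) *
          (∑ ρ : SpinConfig ι, Real.cos (θ * weightedMagnetization lam ρ) * weight c ρ) -
        (∑ ρ : SpinConfig ι, spinAt u ρ * spinAt v ρ *
            Real.cos (θ * weightedMagnetization lam ρ) * weight c ρ) *
          (∑ ρ : SpinConfig ι, spinAt w ρ * Real.sin (θ * weightedMagnetization lam ρ) * weight c ρ) =
      ∑ K : Finset ι, ∑ a : ι, κ K a *
        ((∑ ρ : SpinConfig ι, spinAt a ρ *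
            Real.sin (θ * weightedMagnetization (lamSub K lam) ρ) * weight (cSub K c) ρ) *
          (∑ ρ : SpinConfig ι,
            Real.cos (θ * weightedMagnetization (lamSub K lam) ρ) * weight (cSub K c) ρ)) := by
  obtain ⟨κ, hκ, hid⟩ := exists_kappa_truncated_pair_field hc u v w
  refine ⟨κ, hκ, fun θ => ?_⟩
  -- the two sides as functions of complex fields
  set Fuvw : SpinConfig ι → ℝ := fun ρ => spinAt u ρ * spinAt v ρ * spinAt w ρ with hFuvw
  set Fuv : SpinConfig ι → ℝ := fun ρ => spinAt u ρ * spinAt v ρ with hFuv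
  set f : (ι → ℂ) → ℂ := fun h =>
    sinhSumC c h Fuvw * coshSumC c h (fun _ => 1) - coshSumC c h Fuv * sinhSumC c h (fun ρ => spinAt w ρ)
    with hf
  set g : (ι → ℂ) → ℂ := fun h => ∑ K : Finset ι, ∑ a : ι, (κ K a : ℂ) *
    (sinhSumC (cSub K c) (maskC K h) (fun ρ => spinAt a ρ) * coshSumC (cSub K c) (maskC K h) (fun _ => 1))
    with hg
  have hfg : f = g := by
    refine eq_of_eqOn_nonneg_orthant (fun h x₀ => ?_) (fun h x₀ => ?_) (fun h hh => ?_)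
    · simp only [hf]
      exact ((differentiable_sinhSumC c Fuvw (differentiable_update_apply h x₀)).mul
          (differentiable_coshSumC c _ (differentiable_update_apply h x₀))).sub
        ((differentiable_coshSumC c Fuv (differentiable_update_apply h x₀)).mul
          (differentiable_sinhSumC c _ (differentiable_update_apply h x₀)))
    · simp only [hg]
      refine Differentiable.fun_sum fun K _ => Differentiable.fun_sum fun a _ => ?_
      exact (differentiable_const _).mul
        ((differentiable_sinhSumC _ _ (differentiable_maskC_update_apply K h x₀)).mul
          (differentiable_coshSumC _ _ (differentiable_maskC_update_apply K h x₀)))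
    · simp only [hf, hg, maskC_ofReal, sinhSumC_ofReal, coshSumC_ofReal]
      have := hid h hh
      simp only [hFuvw, hFuv]
      exact_mod_cast congrArg (fun r : ℝ => (r : ℂ)) this
  -- evaluate at `h = iθλ` and take imaginary parts
  have key := congrFun hfg (fun x => I * (θ : ℂ) * (lam x : ℂ))
  simp only [hf, hg, maskC_imag, sinhSumC_imag, coshSumC_imag, hFuvw, hFuv, one_mul] at key
  have k2 := congrArg Complex.im key
  simp only [Complex.sub_im, Complex.mul_im, Complex.mul_re, Complex.ofReal_im, Complex.ofReal_re,
    Complex.I_im, Complex.I_re, Complex.im_sum, mul_zero, zero_mul, sub_zero, add_zero, zero_add,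
    mul_one] at k2
  linarith [k2]

end Complex

end PairIsing

end Literature.Probability.LatticeModels
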